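import Mathlib
import HarnessLib
import Literature.Analysis.FluidPDE.GigaMiura2011UnidirectionalVorticityHolds
import Summits.NavierStokesRegularity.NavierStokesRegularity.Theorems.PoloidalWindowDoorPoloidalWindowRigidityLocalVorticitySymmetry

/-!
# nsreg-p1 ROUND-18 door S19 «LocalTiltingFreeDoor» — LINE 1 «direction rigidity»: the two M-stubs PROVED and
# K2 `TiltingFreeProfileRigidity` REDUCED BY NAME to its hard stub `stub_directionRigidity`

Door S19 (nsreg-p1 g16, `HOME/ns-regularity-ideate-p1/ROUND-18.md`, `r18/Sketch19.lean` 8826b4ea9dfcd4c1; DESIGN-ONLY,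
route NOT born): local space–time Type I at `(x₀,T)` + the scale-normalised VORTEX-TILTING vector `ω × (∇u) ω` fading
in `L¹` on ONE similarity window ⇒ `x₀` is backward bounded.  Its profile crux K2 `TiltingFreeProfileRigidity`
(«a tilting-free Type-I ancient mild profile is not backward-singular», = Galanti–Gibbon–Heritage 1997 §6 Q1 made
precise; OPEN) has the planner's LINE 1 skeleton `r18/TiltingFreeProfileRigidity_birth.lean` dd68cdd5541cf57d:
`stub_windowSpread` (M) → `stub_directionRigidity` (HARD) → `stub_constantDirectionRegular` (M).

This file proves the two M-stubs as stated (texts verbatim, binders of the S16-family door class) and the composition: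

* `tiltingWindowToSlab` = `stub_windowSpread`: the slice tilting field
  `y ↦ curl ∇v(s,y) × (∇v(s,y) (curl ∇v(s,y)))` of a profile of the class is REAL-ANALYTIC (slice analyticity
  `analyticOnNhd_slice`; `fderiv`, `curlCLM`, evaluation and the cross product are analytic operations), so vanishing on
  a nonempty open window of a slice spreads to the whole slice (identity theorem, `vector_eq_zero_spread`);
* `constantDirectionRegular` = `stub_constantDirectionRegular`: if the vorticity of every slice is everywhere parallel to
  one fixed `e ≠ 0`, the profile is `≡ 0` (`eq_zero_of_curl_parallel`), hence not backward-singular: `curl v(s) ∥ e`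
  with `v(s)` real-analytic, divergence-free and bounded makes `v(s)` invariant under the translations along `e`
  (Giga–Miura 2011 Prop. 2.2, tree `translationInvariant_of_curl_parallel`), and ONE translation-invariant slice of a
  profile of the Type-I class forces `v ≡ 0` (tree `…PoloidalWindowRigidityOneSlice.eq_zero_of_translate_eq_slice`).
  In fact ONE slice with parallel vorticity suffices (`eq_zero_of_curl_parallel_slice`);
* `tiltingFreeProfileRigidity_of_directionRigidity`: K2's text follows from the text of the hard stub
  `stub_directionRigidity` alone (LINE 1 closed modulo its load-bearing statement, by name).

Seat nsreg-p6 g10 (THEOREMS-ONLY door sequels, DIRECTOR-NS g8 #32 (2)/#36).  WHAT THIS IS NOT: not NS regularity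
(Clay A); not K2 `TiltingFreeProfileRigidity` and not its hard stub — the settled unidirectional-vorticity stratum and
the analytic glue of a CONDITIONAL one-window door; no route is opened.
-/

noncomputable section

-- the summit and its single sub-problem share the name (CONVENTIONS §1), as in every Theorems file
set_option linter.dupNamespace false

namespace Summit.NavierStokesRegularity.NavierStokesRegularity.Theorems.LocalTiltingFreeDoorDirectionLine

open Set Function Filter Topology Metric
open scoped RealInnerProductSpace InnerProductSpace
open Literature.Analysis Literature.Analysis.FluidPDE
open Summit.NavierStokesRegularity.NavierStokesRegularity.Theorems.LocalSineTubeDoorProfileAlignedWindowRigidityAncient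
open Summit.NavierStokesRegularity.NavierStokesRegularity.Theorems.PoloidalWindowDoorPoloidalWindowRigidityFlat
  (not_backwardSingular_of_zero)
open Summit.NavierStokesRegularity.NavierStokesRegularity.Theorems.PoloidalWindowDoorPoloidalWindowRigidityOneSlice
  (eq_zero_of_translate_eq_slice)

variable {C : ℝ} {v : ℝ → EuclideanSpace ℝ (Fin 3) → EuclideanSpace ℝ (Fin 3)}

/-! ### Analyticity of the slice tilting field and the identity theorem -/

/-- The cross product of two real-analytic vector fields on `ℝ³` is real-analytic (the cross product is a continuous
bilinear map, `crossCLM`). -/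
theorem analyticOnNhd_cross {F G : EuclideanSpace ℝ (Fin 3) → EuclideanSpace ℝ (Fin 3)}
    (hF : AnalyticOnNhd ℝ F univ) (hG : AnalyticOnNhd ℝ G univ) :
    AnalyticOnNhd ℝ (fun y => cross (F y) (G y)) univ := fun y hy =>
  (crossCLM.analyticAt_bilinear (F y, G y)).comp₂ (hF y hy) (hG y hy)

/-- **The tilting field of a slice of the class is real-analytic**:
`y ↦ curl ∇v(s,y) × (∇v(s,y) (curl ∇v(s,y)))` for `s < 0`. -/
theorem analyticOnNhd_tilting_slice (hrate : HasTypeITimeDecay C v)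
    (hcont : ContinuousOn (uncurry v) (Iio (0 : ℝ) ×ˢ univ))
    (hmild : ∀ s t : ℝ, s < t → t < 0 → ∀ x,
      v t x = UnboundedOperators.heatExtension (v s) (t - s) x - oseenDuhamel 1 s v v t x)
    {s : ℝ} (hs : s < 0) :
    AnalyticOnNhd ℝ (fun y => cross (curlCLM (fderiv ℝ (v s) y))
      ((fderiv ℝ (v s) y) (curlCLM (fderiv ℝ (v s) y)))) univ := by
  have hslice := analyticOnNhd_slice hcont (bdd_of_hasTypeITimeDecay hrate) hmild hs
  have hD : AnalyticOnNhd ℝ (fderiv ℝ (v s)) univ := hslice.fderiv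
  have hcurl : AnalyticOnNhd ℝ (fun y => curlCLM (fderiv ℝ (v s) y)) univ := curlCLM.comp_analyticOnNhd hD
  have happ : AnalyticOnNhd ℝ (fun y => (fderiv ℝ (v s) y) (curlCLM (fderiv ℝ (v s) y))) univ := fun y hy =>
    ((ContinuousLinearMap.id ℝ (EuclideanSpace ℝ (Fin 3) →L[ℝ] EuclideanSpace ℝ (Fin 3))).analyticAt_bilinear
      (fderiv ℝ (v s) y, curlCLM (fderiv ℝ (v s) y))).comp₂ (hD y hy) (hcurl y hy)
  exact analyticOnNhd_cross hcurl happ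

/-- Identity-theorem spreading for a real-analytic VECTOR field on `ℝ³`: vanishing on a nonempty open set forces
vanishing everywhere (`ℝ³` is connected). -/
theorem vector_eq_zero_spread {g : EuclideanSpace ℝ (Fin 3) → EuclideanSpace ℝ (Fin 3)} (hg : AnalyticOnNhd ℝ g univ)
    {U : Set (EuclideanSpace ℝ (Fin 3))} (hU : IsOpen U) (hne : U.Nonempty) (h : ∀ y ∈ U, g y = 0) :
    ∀ y, g y = 0 := by
  obtain ⟨y₀, hy₀⟩ := hne
  have hev : g =ᶠ[𝓝 y₀] 0 := Filter.eventually_of_mem (hU.mem_nhds hy₀) fun y hy => h y hy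
  intro y
  exact hg.eqOn_zero_of_preconnected_of_eventuallyEq_zero isPreconnected_univ (mem_univ y₀) hev (mem_univ y)

/-! ### `stub_windowSpread` -/

/-- **`stub_windowSpread` of LINE 1 / LINE 2 (text of nsreg-p1 `r18/TiltingFreeProfileRigidity_birth.lean`, verbatim),
PROVED**: on the door class, if at every `s < 0` the tilting vector `curl ∇v × (∇v (curl ∇v))(s,·)` vanishes on some
nonempty open set, it vanishes identically on every slice (slice analyticity + identity theorem; the space–time decay
and the divergence constraint are not used). -/
theorem tiltingWindowToSlab : ∀ (C D : ℝ) (v : ℝ → EuclideanSpace ℝ (Fin 3) → EuclideanSpace ℝ (Fin 3)), Literature.Analysis.FluidPDE.HasTypeITimeDecay C v → Literature.Analysis.FluidPDE.HasTypeIDecay D v → ContinuousOn (Function.uncurry v) (Set.Iio (0 : ℝ) ×ˢ Set.univ) → (∀ s t : ℝ, s < t → t < 0 → ∀ x, v t x = Literature.Analysis.UnboundedOperators.heatExtension (v s) (t - s) x - Literature.Analysis.FluidPDE.oseenDuhamel 1 s v v t x) → (∀ t < 0, Literature.Analysis.FluidPDE.VectorCalculus.IsDivFree (v t)) → (∀ s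 < 0, ∃ U : Set (EuclideanSpace ℝ (Fin 3)), IsOpen U ∧ U.Nonempty ∧ ∀ z ∈ U, Literature.Analysis.FluidPDE.cross (Literature.Analysis.FluidPDE.curlCLM (fderiv ℝ (v s) z)) ((fderiv ℝ (v s) z) (Literature.Analysis.FluidPDE.curlCLM (fderiv ℝ (v s) z))) = 0) → (∀ s < 0, ∀ z : EuclideanSpace ℝ (Fin 3), Literature.Analysis.FluidPDE.cross (Literature.Analysis.FluidPDE.curlCLM (fderiv ℝ (v s) z)) ((fderiv ℝ (v s) z) (Literature.Analysis.FluidPDE.curlCLM (fderiv ℝ (v s) z))) = 0) := by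
  intro C _ v hrate _ hcont hmild _ hwin s hs
  obtain ⟨U, hU, hne, hal⟩ := hwin s hs
  exact vector_eq_zero_spread (analyticOnNhd_tilting_slice hrate hcont hmild hs) hU hne hal

/-! ### Parallel vorticity: the unidirectional stratum -/

/-- Linear algebra on `ℝ³`: `e × w = 0` with `e ≠ 0` forces `w ∥ e`. -/
theorem exists_eq_smul_of_cross_eq_zero {e w : EuclideanSpace ℝ (Fin 3)} (he : e ≠ 0) (h : cross e w = 0) :
    ∃ a : ℝ, w = a • e := by
  have hc0 : e 1 * w 2 - e 2 * w 1 = 0 := by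
    have := congrArg (fun x : EuclideanSpace ℝ (Fin 3) => x 0) h
    simpa [cross, cross_apply] using this
  have hc1 : e 2 * w 0 - e 0 * w 2 = 0 := by
    have := congrArg (fun x : EuclideanSpace ℝ (Fin 3) => x 1) h
    simpa [cross, cross_apply] using this
  have hc2 : e 0 * w 1 - e 1 * w 0 = 0 := by
    have := congrArg (fun x : EuclideanSpace ℝ (Fin 3) => x 2) h
    simpa [cross, cross_apply] using this
  have hn : ‖e‖ ^ 2 = e 0 ^ 2 + e 1 ^ 2 + e 2 ^ 2 := by
    rw [EuclideanSpace.norm_eq, Real.sq_sqrt (by positivity), Fin.sum_univ_three]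
    simp only [Real.norm_eq_abs, sq_abs]
  have hn0 : e 0 ^ 2 + e 1 ^ 2 + e 2 ^ 2 ≠ 0 := by
    rw [← hn]; exact pow_ne_zero 2 (norm_ne_zero_iff.2 he)
  refine ⟨(e 0 * w 0 + e 1 * w 1 + e 2 * w 2) / (e 0 ^ 2 + e 1 ^ 2 + e 2 ^ 2), ?_⟩
  set a : ℝ := (e 0 * w 0 + e 1 * w 1 + e 2 * w 2) / (e 0 ^ 2 + e 1 ^ 2 + e 2 ^ 2) with ha
  have h0 : w 0 = a * e 0 := by
    rw [ha]; field_simp; linear_combination (-(e 1)) * hc2 + e 2 * hc1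
  have h1 : w 1 = a * e 1 := by
    rw [ha]; field_simp; linear_combination e 0 * hc2 - e 2 * hc0
  have h2 : w 2 = a * e 2 := by
    rw [ha]; field_simp; linear_combination (-(e 0)) * hc1 + e 1 * hc0
  ext i
  rw [PiLp.smul_apply, smul_eq_mul]
  fin_cases i
  · exact h0
  · exact h1
  · exact h2

/-- **One slice with parallel vorticity kills the profile.**  A profile of the Type-I class (time rate, continuity on the
open backward slab, Oseen–Duhamel identity, divergence-free slices) whose vorticity on ONE slice `s < 0` is everywhere
parallel to a fixed `e ≠ 0` vanishes identically: the slice is real-analytic, bounded and divergence-free, so it is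
invariant under the translations along `e` (Giga–Miura 2011 Prop. 2.2, tree `translationInvariant_of_curl_parallel`), and
the tree's one-slice translation stratum `eq_zero_of_translate_eq_slice` concludes. -/
theorem eq_zero_of_curl_parallel_slice (hrate : HasTypeITimeDecay C v)
    (hcont : ContinuousOn (uncurry v) (Iio (0 : ℝ) ×ˢ univ))
    (hmild : ∀ s t : ℝ, s < t → t < 0 → ∀ x,
      v t x = UnboundedOperators.heatExtension (v s) (t - s) x - oseenDuhamel 1 s v v t x)
    (hdiv : ∀ t < 0, VectorCalculus.IsDivFree (v t)) {s : ℝ} (hs : s < 0)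
    {e : EuclideanSpace ℝ (Fin 3)} (he : e ≠ 0) (hpar : ∀ z, cross e (curlCLM (fderiv ℝ (v s) z)) = 0) :
    ∀ t < 0, ∀ x, v t x = 0 := by
  have hC2 : ContDiff ℝ 2 (v s) := (analyticOnNhd_slice hcont (bdd_of_hasTypeITimeDecay hrate) hmild hs).contDiff
  have hbdd : ∃ M : ℝ, ∀ x, ‖v s x‖ ≤ M := ⟨C / Real.sqrt (-s), fun x => hrate s hs x⟩
  have hpar' : ∀ x, ∃ a : ℝ, curl (v s) x = a • e := fun x =>
    exists_eq_smul_of_cross_eq_zero he (by rw [curl_eq_curlCLM]; exact hpar x)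
  have hinv : ∀ (y : EuclideanSpace ℝ (Fin 3)) (l : ℝ), v s (y + l • e) = v s y :=
    translationInvariant_of_curl_parallel hC2 (hdiv s hs) hbdd he hpar'
  exact eq_zero_of_translate_eq_slice hrate hcont hmild hdiv hs he hinv

/-- **The unidirectional stratum** (all slices): vorticity everywhere parallel to a fixed `e ≠ 0` on every slice
⇒ `v ≡ 0`. -/
theorem eq_zero_of_curl_parallel (hrate : HasTypeITimeDecay C v)
    (hcont : ContinuousOn (uncurry v) (Iio (0 : ℝ) ×ˢ univ))
    (hmild : ∀ s t : ℝ, s < t → t < 0 → ∀ x,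
      v t x = UnboundedOperators.heatExtension (v s) (t - s) x - oseenDuhamel 1 s v v t x)
    (hdiv : ∀ t < 0, VectorCalculus.IsDivFree (v t))
    {e : EuclideanSpace ℝ (Fin 3)} (he : e ≠ 0) (hpar : ∀ s < 0, ∀ z, cross e (curlCLM (fderiv ℝ (v s) z)) = 0) :
    ∀ t < 0, ∀ x, v t x = 0 :=
  eq_zero_of_curl_parallel_slice hrate hcont hmild hdiv (show (-1 : ℝ) < 0 by norm_num) he (hpar (-1) (by norm_num))

/-! ### `stub_constantDirectionRegular` -/

/-- **`stub_constantDirectionRegular` of LINE 1 (text of nsreg-p1 `r18/TiltingFreeProfileRigidity_birth.lean`, verbatim),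
PROVED**: a door-class profile whose vorticity is everywhere parallel to one fixed nonzero vector is not backward-singular
at the apex (it is `≡ 0`, `eq_zero_of_curl_parallel`; the space–time decay is not used). -/
theorem constantDirectionRegular : ∀ (C D : ℝ) (v : ℝ → EuclideanSpace ℝ (Fin 3) → EuclideanSpace ℝ (Fin 3)), Literature.Analysis.FluidPDE.HasTypeITimeDecay C v → Literature.Analysis.FluidPDE.HasTypeIDecay D v → ContinuousOn (Function.uncurry v) (Set.Iio (0 : ℝ) ×ˢ Set.univ) → (∀ s t : ℝ, s < t → t < 0 → ∀ x, v t x = Literature.Analysis.UnboundedOperators.heatExtension (v s) (t - s) x - Literature.Analysis.FluidPDE.oseenDuhamel 1 s v v t x) → (∀ t < 0, Literature.Analysis.FluidPDE.VectorCalculus.IsDivFree (v t)) → (∃ e : EuclideanSpace ℝ (Fin 3), e ≠ 0 ∧ ∀ s < 0, ∀ z : EuclideanSpace ℝ (Fin 3), Literature.Analysis.FluidPDE.cross e (Literature.Analysis.FluidPDE.curlCLM (fderiv ℝ (v s) z)) = 0) → ¬ Literature.Analysis.FluidPDE.IsBackwardSingularPoint v 0 := by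
  intro C _ v hrate _ hcont hmild hdiv hdir
  obtain ⟨e, he, hpar⟩ := hdir
  exact not_backwardSingular_of_zero (eq_zero_of_curl_parallel hrate hcont hmild hdiv he hpar)

/-! ### K2 reduced to the hard stub of LINE 1 -/

/-- **LINE 1 closed modulo its hard stub, by name**: the text of K2 `TiltingFreeProfileRigidity` of nsreg-p1
`r18/Sketch19.lean` follows from the text of `stub_directionRigidity` («an everywhere tilting-free door-class profile has
constant vorticity direction») — `tiltingWindowToSlab` feeds it and `constantDirectionRegular` finishes
(the planner's composition `TiltingFreeProfileRigidity_of` with the two M-stubs discharged). -/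
theorem tiltingFreeProfileRigidity_of_directionRigidity
    (hdir : ∀ (C D : ℝ) (v : ℝ → EuclideanSpace ℝ (Fin 3) → EuclideanSpace ℝ (Fin 3)), Literature.Analysis.FluidPDE.HasTypeITimeDecay C v → Literature.Analysis.FluidPDE.HasTypeIDecay D v → ContinuousOn (Function.uncurry v) (Set.Iio (0 : ℝ) ×ˢ Set.univ) → (∀ s t : ℝ, s < t → t < 0 → ∀ x, v t x = Literature.Analysis.UnboundedOperators.heatExtension (v s) (t - s) x - Literature.Analysis.FluidPDE.oseenDuhamel 1 s v v t x) → (∀ t < 0, Literature.Analysis.FluidPDE.VectorCalculus.IsDivFree (v t)) → (∀ s < 0, ∀ z : EuclideanSpace ℝ (Fin 3), Literature.Analysis.FluidPDE.cross (Literature.Analysis.FluidPDE.curlCLM (fderiv ℝ (v s) z)) ((fderiv ℝ (v s) z) (Literature.Analysis.FluidPDE.curlCLM (fderiv ℝ (v s) z))) = 0) → (∃ e : EuclideanSpace ℝ (Fin 3), e ≠ 0 ∧ ∀ s < 0, ∀ z : EuclideanSpace ℝ (Fin 3), Literature.Analysis.FluidPDE.cross e (Literature.Analysis.FluidPDE.curlCLM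 (fderiv ℝ (v s) z)) = 0)) :
    ∀ (C D : ℝ) (v : ℝ → EuclideanSpace ℝ (Fin 3) → EuclideanSpace ℝ (Fin 3)), Literature.Analysis.FluidPDE.HasTypeITimeDecay C v → Literature.Analysis.FluidPDE.HasTypeIDecay D v → ContinuousOn (Function.uncurry v) (Set.Iio (0 : ℝ) ×ˢ Set.univ) → (∀ s t : ℝ, s < t → t < 0 → ∀ x, v t x = Literature.Analysis.UnboundedOperators.heatExtension (v s) (t - s) x - Literature.Analysis.FluidPDE.oseenDuhamel 1 s v v t x) → (∀ t < 0, Literature.Analysis.FluidPDE.VectorCalculus.IsDivFree (v t)) → (∀ s < 0, ∃ U : Set (EuclideanSpace ℝ (Fin 3)), IsOpen U ∧ U.Nonempty ∧ ∀ z ∈ U, Literature.Analysis.FluidPDE.cross (Literature.Analysis.FluidPDE.curlCLM (fderiv ℝ (v s) z)) ((fderiv ℝ (v s) z) (Literature.Analysis.FluidPDE.curlCLM (fderiv ℝ (v s) z))) = 0) → ¬ Literature.Analysis.FluidPDE.IsBackwardSingularPoint v 0 := by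
  intro C D v hrate hdecay hcont hmild hdiv hwin
  exact constantDirectionRegular C D v hrate hdecay hcont hmild hdiv
    (hdir C D v hrate hdecay hcont hmild hdiv (tiltingWindowToSlab C D v hrate hdecay hcont hmild hdiv hwin))

end Summit.NavierStokesRegularity.NavierStokesRegularity.Theorems.LocalTiltingFreeDoorDirectionLine

end
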